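import Summits.KontsevichZagierPeriods.KontsevichZagierPeriods.Theorems.LinRedNormalFormArrangementNormalFormSeparateThreeKPiece
import Summits.KontsevichZagierPeriods.KontsevichZagierPeriods.Theorems.LinRedNormalFormArrangementNormalFormSeparateThreeHHKFinal

/-!
# Stub `stub_rebaseSimplePosOnePos` (crux `ArrangementNormalForm`, line `janus-bands`) —
part `HUPiece`: the separation engine preserves a rebased fibre structure

Towards the residue `HU` of the one-fibre rebase at `B = 2` (thin parallel cells with a triple
point at positive pole distance), which is treated by RE-SELECTING a generic base direction as the
distinguished coordinate: after a level split and two affine pull-backs the band has, in the new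
frame, one fibre bound EQUAL to the new distinguished coordinate `ỹ`, the other bound and the
letter `ỹ`-free — the fibre structure of the class `GG b 2 k` —, but its base factor is an
arbitrary arrangement `P(x̃', ỹ)/∏ Lⱼ(x̃', ỹ)^{eⱼ}` in the new frame. This file records that the
separation engine with fibres (part `KPiece` of `stub_separateHigh`) never touches the fibre
data `(a, lo, hi)` nor the base cell: if they satisfy the `σ = 2` conditions of `GG b 2 k`
(`ha2`, `hb2`), every terminal piece of the engine and every term of the final Taylor split is
LITERALLY in `GG b 2 k`, so the piece theorem lands in `closure (GG b 2 k)`: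
* `split_sigmaTwo` — the numerator split `GG♮ → GG` (`separatePos_split`, rule 1b) with the
  target `GG b 2 k`;
* `SepThreeK.terminal_of_hH_two`, `SepThreeK.piece_sigmaTwo` — `terminal_of_hH`, `piece` of
  part `KPiece` verbatim with the terminal class `closure (GG b 2 k)`;
* `SepThreeK.piece_sigmaTwo_three` — engine base dimension `3` (`b = 2`), UNCONDITIONAL: the
  termwise-convergence lemma is `separateThree_hHk` (part `HHKFinal`). Registered as
  `rebaseSimplePos_pieceSigmaTwo`.

References: M. Kontsevich, D. Zagier, *Periods* (2001), §1.2, rule (1b).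
-/

noncomputable section

open Set MeasureTheory Filter Topology

namespace Summit.KontsevichZagierPeriods.ArrangementNormalForm.JanusBands

open Literature.NumberTheory.Transcendental

section Split

open SeparatePos MvPolynomial

/-- **The numerator split `GG♮ → GG` with the target `GG b 2 k`**: as `separatePos_split`, for
fibre data satisfying the `σ = 2` conditions (`ha2`: letters free of `y`; `hb2`: affine bounds
free of `y` or equal to `y`). The terms keep `(M, L, e, a, lo, hi)`. -/
theorem split_sigmaTwo (b k m m' n : ℕ) (s : KZ.IntegralRep (b + 1 + k)) (M : Fin m' → (Fin (b + 1) → ℚ) × ℚ) (L : Fin m → (Fin b → ℚ) × ℚ) (e : Fin m → ℕ) (p : MvPolynomial (Fin (b + 1)) ℚ) (ℓ : (Fin b → ℚ) × ℚ) (a : Fin k → Option ((Fin (b + 1) → ℚ) × ℚ)) (lo hi : Fin k → Fin k ⊕ ((Fin (b + 1) → ℚ) × ℚ)) (hpole : n ≠ 0 → ∀ z ∈ s.domain, (z (Fin.castAdd k (Fin.last b)) - (∑ i, (ℓ.1 i : ℝ) * z (Fin.castAdd k (Fin.castSucc i)) + (ℓ.2 : ℝ))) ≠ 0) (hbd : Bornology.IsBounded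 s.domain) (hdom : s.domain = {z | (∀ j, 0 < ∑ i, ((M j).1 i : ℝ) * z (Fin.castAdd k i) + ((M j).2 : ℝ)) ∧ ∀ i, Sum.elim (fun j => z (Fin.natAdd (b + 1) j)) (fun c => ∑ i', (c.1 i' : ℝ) * z (Fin.castAdd k i') + (c.2 : ℝ)) (lo i) < z (Fin.natAdd (b + 1) i) ∧ z (Fin.natAdd (b + 1) i) < Sum.elim (fun j => z (Fin.natAdd (b + 1) j)) (fun c => ∑ i', (c.1 i' : ℝ) * z (Fin.castAdd k i') + (c.2 : ℝ)) (hi i)}) (hint : EqOn s.integrand (fun z => MvPolynomial.aeval (fun i => z (Fin.castAdd k i)) p / (∏ j, (∑ i, ((L j).1 i : ℝ) * z (Fin.castAdd k (Fin.castSucc i)) + ((L j).2 : ℝ)) ^ e j) * (1 / (z (Fin.castAdd k (Fin.last b)) - (∑ i, (ℓ.1 i : ℝ) * z (Fin.castAdd k (Fin.castSucc i)) + (ℓ.2 : ℝ))) ^ n) * ∏ i, (a i).elim 1 (fun c => 1 / (z (Fin.natAdd (b + 1) i) - (∑ i', (c.1 i' : ℝ) * z (Fin.castAdd k i') + (c.2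 : ℝ))))) s.domain) (N : ℕ) (q : ℕ → MvPolynomial (Fin b) ℚ) (hq : ∀ z : Fin (b + 1 + k) → ℝ, MvPolynomial.aeval (fun i => z (Fin.castAdd k i)) p = ∑ i ∈ Finset.range N, MvPolynomial.aeval (fun i => z (Fin.castAdd k (Fin.castSucc i))) (q i) * (z (Fin.castAdd k (Fin.last b)) - (∑ i, (ℓ.1 i : ℝ) * z (Fin.castAdd k (Fin.castSucc i)) + (ℓ.2 : ℝ))) ^ i) (hI : ∀ i ∈ Finset.range N, IntegrableOn (fun z => MvPolynomial.aeval (fun i => z (Fin.castAdd k (Fin.castSucc i))) (q i) / (∏ j, (∑ i, ((L j).1 i : ℝ) * z (Fin.castAdd k (Fin.castSucc i)) + ((L j).2 : ℝ)) ^ e j) * ((z (Fin.castAdd k (Fin.last b)) - (∑ i, (ℓ.1 i : ℝ) * z (Fin.castAdd k (Fin.castSucc i)) + (ℓ.2 : ℝ))) ^ i / (z (Fin.castAdd k (Fin.last b)) - (∑ i, (ℓ.1 i : ℝ) * z (Fin.castAdd k (Fin.castSucc i)) + (ℓ.2 : ℝ))) ^ n) * ∏ i, (a i).elim 1 (fun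 c => 1 / (z (Fin.natAdd (b + 1) i) - (∑ i', (c.1 i' : ℝ) * z (Fin.castAdd k i') + (c.2 : ℝ))))) s.domain) (ha2 : ∀ i c, a i = some c → c.1 (Fin.last b) = 0) (hb2 : ∀ i c, (lo i = Sum.inr c ∨ hi i = Sum.inr c) → (c.1 (Fin.last b) = 0 ∨ c = (Pi.single (Fin.last b) 1, 0))) : ∃ c ∈ AddSubgroup.closure (SeparatePos.GGset b 2 k), KZ.of s - c ∈ KZ.relations := by
  have hσ := s.isSemialgebraic_domain
  set g : Fin N → (Fin (b + 1 + k) → ℝ) → ℝ := fun i z => MvPolynomial.aeval (fun i => z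
    (Fin.castAdd k (Fin.castSucc i))) (q i) / (∏ j, (affB b k (L j) z) ^ e j) *
    ((z (Fin.castAdd k (Fin.last b)) - affB b k ℓ z) ^ (i : ℕ) /
      (z (Fin.castAdd k (Fin.last b)) - affB b k ℓ z) ^ n) * fib b k a z with hg
  have hsa : ∀ i, IsSemialgebraicFunOn ℚ s.domain (g i) := fun i =>
    isSemialgebraicFunOn_term hσ L e (q i) ℓ a i n
  set R : Fin N → KZ.IntegralRep (b + 1 + k) := fun i =>
    ⟨s.domain, g i, hσ, hsa i, hI i (Finset.mem_range.2 i.isLt)⟩ with hR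
  have hrel : KZ.of s - ∑ i, KZ.of (R i) ∈ KZ.relations := by
    refine KZ.of_sub_sum_integrand_mem_relations Finset.univ R s (fun i _ => rfl) fun z hz => ?_
    rw [hint hz]
    show MvPolynomial.aeval (fun i => z (Fin.castAdd k i)) p / (∏ j, (affB b k (L j) z) ^ e j) *
      (1 / (z (Fin.castAdd k (Fin.last b)) - affB b k ℓ z) ^ n) * fib b k a z = ∑ i, g i z
    rw [hq z, ← Fin.sum_univ_eq_sum_range, Finset.sum_div, Finset.sum_mul, Finset.sum_mul]
    refine Finset.sum_congr rfl fun i _ => ?_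
    simp only [hg, affB]
    ring
  have hmem : ∀ i, KZ.of (R i) ∈ GGset b 2 k := fun i => by
    by_cases hin : (i : ℕ) < n
    · refine ⟨m, m', 0, n - i, R i, M, L, e, q i, ℓ, ℓ, a, lo, hi, Or.inl rfl,
        fun _ => ⟨ha2, hb2⟩, hbd, hdom, fun z hz => ?_, rfl⟩
      show g i z = _
      simp only [hg, affB, fib, pow_div_pow_eq (hpole · z hz), if_pos hin]
    · refine ⟨m, m', i - n, 0, R i, M, L, e, q i, ℓ, ℓ, a, lo, hi, Or.inr rfl,
        fun _ => ⟨ha2, hb2⟩, hbd, hdom, fun z hz => ?_, rfl⟩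
      show g i z = _
      simp only [hg, affB, fib, pow_div_pow_eq (hpole · z hz), if_neg hin]
  exact ⟨∑ i, KZ.of (R i), AddSubgroup.sum_mem _ fun i _ => AddSubgroup.subset_closure (hmem i),
    hrel⟩

end Split

namespace SepThreeK

open SeparatePos SepThree MvPolynomial

/-- **Terminal theorem of the engine with fibres, target `GG b 2 k`**: `terminal_of_hH` for fibre
data satisfying the `σ = 2` conditions. -/
theorem terminal_of_hH_two {b k : ℕ}
    (hHb : ∀ (b' k' m m' n : ℕ) (s : KZ.IntegralRep (b' + 1 + k')) (M : Fin m' → (Fin (b' + 1) → ℚ) × ℚ) (L : Fin m → (Fin b' → ℚ) × ℚ) (e : Fin m → ℕ) (p : MvPolynomial (Fin (b' + 1)) ℚ) (ℓ : (Fin b' → ℚ) × ℚ) (a : Fin k' → Option ((Fin (b' + 1) → ℚ) × ℚ)) (lo hi : Fin k' → Fin k' ⊕ ((Fin (b' + 1) → ℚ) × ℚ)) (hpole : n ≠ 0 → ∀ z ∈ s.domain, (z (Fin.castAdd k' (Fin.last b')) - (∑ i, (ℓ.1 i : ℝ) * z (Fin.castAdd k' (Fin.castSucc i)) + (ℓ.2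 : ℝ))) ≠ 0) (hbd : Bornology.IsBounded s.domain) (hdom : s.domain = {z | (∀ j, 0 < ∑ i, ((M j).1 i : ℝ) * z (Fin.castAdd k' i) + ((M j).2 : ℝ)) ∧ ∀ i, Sum.elim (fun j => z (Fin.natAdd (b' + 1) j)) (fun c => ∑ i', (c.1 i' : ℝ) * z (Fin.castAdd k' i') + (c.2 : ℝ)) (lo i) < z (Fin.natAdd (b' + 1) i) ∧ z (Fin.natAdd (b' + 1) i) < Sum.elim (fun j => z (Fin.natAdd (b' + 1) j)) (fun c => ∑ i', (c.1 i' : ℝ) * z (Fin.castAdd k' i') + (c.2 : ℝ)) (hi i)}) (hint : EqOn s.integrand (fun z => MvPolynomial.aeval (fun i => z (Fin.castAdd k' i)) p / (∏ j, (∑ i, ((L j).1 i : ℝ) * z (Fin.castAdd k' (Fin.castSucc i)) + ((L j).2 : ℝ)) ^ e j) * (1 / (z (Fin.castAdd k' (Fin.last b')) - (∑ i, (ℓ.1 i : ℝ) * z (Fin.castAdd k' (Fin.castSucc i)) + (ℓ.2 : ℝ))) ^ n) * ∏ i, (a i).elim 1 (fun c => 1 / (z (Fin.natAdd (b' + 1)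 i) - (∑ i', (c.1 i' : ℝ) * z (Fin.castAdd k' i') + (c.2 : ℝ))))) s.domain) (N : ℕ) (q : ℕ → MvPolynomial (Fin b') ℚ) (hq : ∀ z : Fin (b' + 1 + k') → ℝ, MvPolynomial.aeval (fun i => z (Fin.castAdd k' i)) p = ∑ i ∈ Finset.range N, MvPolynomial.aeval (fun i => z (Fin.castAdd k' (Fin.castSucc i))) (q i) * (z (Fin.castAdd k' (Fin.last b')) - (∑ i, (ℓ.1 i : ℝ) * z (Fin.castAdd k' (Fin.castSucc i)) + (ℓ.2 : ℝ))) ^ i) (hb : b' = b) (hH : ∀ j, e j ≠ 0 → ∀ z ∈ closure s.domain, (∑ i, ((L j).1 i : ℝ) * z (Fin.castAdd k' (Fin.castSucc i)) + ((L j).2 : ℝ)) = 0 → (n ≠ 0 ∧ z (Fin.castAdd k' (Fin.last b')) = ∑ i, (ℓ.1 i : ℝ) * z (Fin.castAdd k' (Fin.castSucc i)) + (ℓ.2 : ℝ))), ∀ i ∈ Finset.range N, IntegrableOn (fun z => MvPolynomial.aeval (fun i => z (Fin.castAdd k' (Fin.castSucc i))) (q i) / (∏ j, (∑ i, ((L j).1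 i : ℝ) * z (Fin.castAdd k' (Fin.castSucc i)) + ((L j).2 : ℝ)) ^ e j) * ((z (Fin.castAdd k' (Fin.last b')) - (∑ i, (ℓ.1 i : ℝ) * z (Fin.castAdd k' (Fin.castSucc i)) + (ℓ.2 : ℝ))) ^ i / (z (Fin.castAdd k' (Fin.last b')) - (∑ i, (ℓ.1 i : ℝ) * z (Fin.castAdd k' (Fin.castSucc i)) + (ℓ.2 : ℝ))) ^ n) * ∏ i, (a i).elim 1 (fun c => 1 / (z (Fin.natAdd (b' + 1) i) - (∑ i', (c.1 i' : ℝ) * z (Fin.castAdd k' i') + (c.2 : ℝ))))) s.domain)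
    {m' r : ℕ} (M : Fin m' → (Fin (b + 1) → ℚ) × ℚ)
    (p : MvPolynomial (Fin (b + 1)) ℚ) (lam : Fin r → (Fin b → ℚ) × ℚ)
    (a : Fin k → Option ((Fin (b + 1) → ℚ) × ℚ))
    (lo up : Fin k → Fin k ⊕ ((Fin (b + 1) → ℚ) × ℚ))
    {m : ℕ} (L : Fin m → (Fin b → ℚ) × ℚ) (e : Fin m → ℕ) (d : Fin r → ℕ)
    (s : KZ.IntegralRep (b + 1 + k)) (ℓ : (Fin b → ℚ) × ℚ)
    (hbd : Bornology.IsBounded s.domain) (hdom : s.domain = gDom b k m' M lo up)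
    (hint : EqOn s.integrand (shape b k p L e lam d a) s.domain)
    (hpole : ∀ j, d j ≠ 0 → ∀ z ∈ s.domain,
      z (Fin.castAdd k (Fin.last b)) - affB b k (lam j) z ≠ 0)
    (hℓ : ∀ j, d j ≠ 0 → lam j = ℓ)
    (hInv : ∀ l, e l ≠ 0 → ∀ z ∈ closure s.domain, affB b k (L l) z = 0 →
      (∃ i, d i ≠ 0) ∧ ∀ i, d i ≠ 0 → z (Fin.castAdd k (Fin.last b)) = affB b k (lam i) z)
    (ha2 : ∀ i c, a i = some c → c.1 (Fin.last b) = 0)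
    (hb2 : ∀ i c, (lo i = Sum.inr c ∨ up i = Sum.inr c) →
      (c.1 (Fin.last b) = 0 ∨ c = (Pi.single (Fin.last b) 1, 0))) :
    ∃ c ∈ AddSubgroup.closure (GGset b 2 k), KZ.of s - c ∈ KZ.relations := by
  set n := ∑ j, d j with hn
  -- single-pole form of the integrand
  have hint' : EqOn s.integrand (fun z => MvPolynomial.aeval (fun i => z (Fin.castAdd k i)) p /
      (∏ j, (∑ i, ((L j).1 i : ℝ) * z (Fin.castAdd k (Fin.castSucc i)) + ((L j).2 : ℝ)) ^ e j) *
      (1 / (z (Fin.castAdd k (Fin.last b)) - (∑ i, (ℓ.1 i : ℝ) * z (Fin.castAdd k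
        (Fin.castSucc i)) + (ℓ.2 : ℝ))) ^ n) *
      ∏ i, (a i).elim 1 (fun c => 1 / (z (Fin.natAdd (b + 1) i) -
        (∑ i', (c.1 i' : ℝ) * z (Fin.castAdd k i') + (c.2 : ℝ))))) s.domain := by
    intro z hz
    rw [hint hz]
    simp only [shape, fib, affB, one_div]
    congr 2
    rw [← Finset.prod_pow_eq_pow_sum, ← Finset.prod_inv_distrib]
    refine Finset.prod_congr rfl fun j _ => ?_
    by_cases hj : d j = 0
    · simp [hj]
    · rw [hℓ j hj]
  have hact : n ≠ 0 → ∃ j, d j ≠ 0 := fun h => by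
    by_contra hall; push Not at hall
    exact h (Finset.sum_eq_zero fun j _ => hall j)
  have hpole' : n ≠ 0 → ∀ z ∈ s.domain, z (Fin.castAdd k (Fin.last b)) -
      (∑ i, (ℓ.1 i : ℝ) * z (Fin.castAdd k (Fin.castSucc i)) + (ℓ.2 : ℝ)) ≠ 0 := fun h z hz => by
    obtain ⟨j, hj⟩ := hact h
    have := hpole j hj z hz
    rwa [hℓ j hj] at this
  -- the wall invariant of the surviving pole from the contact invariant
  have hH : ∀ j, e j ≠ 0 → ∀ z ∈ closure s.domain, (∑ i, ((L j).1 i : ℝ) *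
      z (Fin.castAdd k (Fin.castSucc i)) + ((L j).2 : ℝ)) = 0 →
      (n ≠ 0 ∧ z (Fin.castAdd k (Fin.last b)) = ∑ i, (ℓ.1 i : ℝ) * z (Fin.castAdd k
        (Fin.castSucc i)) + (ℓ.2 : ℝ)) := by
    intro j hej z hz h0
    obtain ⟨⟨i, hi⟩, hall⟩ := hInv j hej z hz h0
    refine ⟨fun h => hi ((Finset.sum_eq_zero_iff.1 h) i (Finset.mem_univ _)), ?_⟩
    have h1 := hall i hi
    rw [hℓ i hi] at h1
    exact h1
  obtain ⟨N, q, hq⟩ := separatePos_taylor b k p ℓ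
  exact split_sigmaTwo b k m m' n s M L e p ℓ a lo up hpole' hbd hdom
    hint' N q hq (hHb b k m m' n s M L e p ℓ a lo up hpole' hbd hdom hint' N q hq rfl hH) ha2 hb2

/-- **Piece theorem of the engine with fibres, target `GG b 2 k`**: `piece` (engine coordinates,
every active non-constant letter a `y`-letter, active letters non-vanishing on the cell, ratio
conditions) for fibre data satisfying the `σ = 2` conditions; the separation tree
(`SepThree.sepC_induction`) keeps the cell and the fibre data, so every leaf is
`terminal_of_hH_two`. -/
theorem piece_sigmaTwo {b k : ℕ}
    (hHb : ∀ (b' k' m m' n : ℕ) (s : KZ.IntegralRep (b' + 1 + k')) (M : Fin m' → (Fin (b' + 1) → ℚ) × ℚ) (L : Fin m → (Fin b' → ℚ) × ℚ) (e : Fin m → ℕ) (p : MvPolynomial (Fin (b' + 1)) ℚ) (ℓ : (Fin b' → ℚ) × ℚ) (a : Fin k' → Option ((Fin (b' + 1) → ℚ) × ℚ)) (lo hi : Fin k' → Fin k' ⊕ ((Fin (b' + 1) → ℚ) × ℚ)) (hpole : n ≠ 0 → ∀ z ∈ s.domain, (z (Fin.castAdd k' (Fin.last b')) - (∑ i, (ℓ.1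 i : ℝ) * z (Fin.castAdd k' (Fin.castSucc i)) + (ℓ.2 : ℝ))) ≠ 0) (hbd : Bornology.IsBounded s.domain) (hdom : s.domain = {z | (∀ j, 0 < ∑ i, ((M j).1 i : ℝ) * z (Fin.castAdd k' i) + ((M j).2 : ℝ)) ∧ ∀ i, Sum.elim (fun j => z (Fin.natAdd (b' + 1) j)) (fun c => ∑ i', (c.1 i' : ℝ) * z (Fin.castAdd k' i') + (c.2 : ℝ)) (lo i) < z (Fin.natAdd (b' + 1) i) ∧ z (Fin.natAdd (b' + 1) i) < Sum.elim (fun j => z (Fin.natAdd (b' + 1) j)) (fun c => ∑ i', (c.1 i' : ℝ) * z (Fin.castAdd k' i') + (c.2 : ℝ)) (hi i)}) (hint : EqOn s.integrand (fun z => MvPolynomial.aeval (fun i => z (Fin.castAdd k' i)) p / (∏ j, (∑ i, ((L j).1 i : ℝ) * z (Fin.castAdd k' (Fin.castSucc i)) + ((L j).2 : ℝ)) ^ e j) * (1 / (z (Fin.castAdd k' (Fin.last b')) - (∑ i, (ℓ.1 i : ℝ) * z (Fin.castAdd k' (Fin.castSucc i)) + (ℓ.2 : ℝ))) ^ n) *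 ∏ i, (a i).elim 1 (fun c => 1 / (z (Fin.natAdd (b' + 1) i) - (∑ i', (c.1 i' : ℝ) * z (Fin.castAdd k' i') + (c.2 : ℝ))))) s.domain) (N : ℕ) (q : ℕ → MvPolynomial (Fin b') ℚ) (hq : ∀ z : Fin (b' + 1 + k') → ℝ, MvPolynomial.aeval (fun i => z (Fin.castAdd k' i)) p = ∑ i ∈ Finset.range N, MvPolynomial.aeval (fun i => z (Fin.castAdd k' (Fin.castSucc i))) (q i) * (z (Fin.castAdd k' (Fin.last b')) - (∑ i, (ℓ.1 i : ℝ) * z (Fin.castAdd k' (Fin.castSucc i)) + (ℓ.2 : ℝ))) ^ i) (hb : b' = b) (hH : ∀ j, e j ≠ 0 → ∀ z ∈ closure s.domain, (∑ i, ((L j).1 i : ℝ) * z (Fin.castAdd k' (Fin.castSucc i)) + ((L j).2 : ℝ)) = 0 → (n ≠ 0 ∧ z (Fin.castAdd k' (Fin.last b')) = ∑ i, (ℓ.1 i : ℝ) * z (Fin.castAdd k' (Fin.castSucc i)) + (ℓ.2 : ℝ))), ∀ i ∈ Finset.range N, IntegrableOn (fun z => MvPolynomial.aeval (fun i => z (Fin.castAdd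 k' (Fin.castSucc i))) (q i) / (∏ j, (∑ i, ((L j).1 i : ℝ) * z (Fin.castAdd k' (Fin.castSucc i)) + ((L j).2 : ℝ)) ^ e j) * ((z (Fin.castAdd k' (Fin.last b')) - (∑ i, (ℓ.1 i : ℝ) * z (Fin.castAdd k' (Fin.castSucc i)) + (ℓ.2 : ℝ))) ^ i / (z (Fin.castAdd k' (Fin.last b')) - (∑ i, (ℓ.1 i : ℝ) * z (Fin.castAdd k' (Fin.castSucc i)) + (ℓ.2 : ℝ))) ^ n) * ∏ i, (a i).elim 1 (fun c => 1 / (z (Fin.natAdd (b' + 1) i) - (∑ i', (c.1 i' : ℝ) * z (Fin.castAdd k' i') + (c.2 : ℝ))))) s.domain)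
    {m m' : ℕ} (s : KZ.IntegralRep (b + 1 + k))
    (M : Fin m' → (Fin (b + 1) → ℚ) × ℚ) (L : Fin m → (Fin (b + 1) → ℚ) × ℚ) (e : Fin m → ℕ)
    (p : MvPolynomial (Fin (b + 1)) ℚ) (a : Fin k → Option ((Fin (b + 1) → ℚ) × ℚ))
    (lo hi : Fin k → Fin k ⊕ ((Fin (b + 1) → ℚ) × ℚ))
    (hbd : Bornology.IsBounded s.domain) (hdom : s.domain = gDom b k m' M lo hi)
    (hint : EqOn s.integrand (fun z => MvPolynomial.aeval (fun i => z (Fin.castAdd k i)) p /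
      (∏ j, affF b k (L j) z ^ e j) * fib b k a z) s.domain)
    (hact : ∀ j, e j ≠ 0 → (L j).1 ≠ 0 → (L j).1 (Fin.last b) ≠ 0)
    (hpole : ∀ j, (L j).1 (Fin.last b) ≠ 0 → e j ≠ 0 → ∀ z ∈ s.domain, affF b k (L j) z ≠ 0)
    (hrat : ∀ j j', (L j).1 (Fin.last b) ≠ 0 → (L j').1 (Fin.last b) ≠ 0 → e j ≠ 0 → e j' ≠ 0 →
      (L j').1 (Fin.last b) • L j ≠ (L j).1 (Fin.last b) • L j' → ∃ C : ℝ, ∀ z ∈ s.domain,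
      |affF b k (L j') z| ≤ C * |((L j).1 (Fin.last b) : ℝ) * affF b k (L j') z -
        ((L j').1 (Fin.last b) : ℝ) * affF b k (L j) z|)
    (ha2 : ∀ i c, a i = some c → c.1 (Fin.last b) = 0)
    (hb2 : ∀ i c, (lo i = Sum.inr c ∨ hi i = Sum.inr c) →
      (c.1 (Fin.last b) = 0 ∨ c = (Pi.single (Fin.last b) 1, 0))) :
    ∃ c ∈ AddSubgroup.closure (GGset b 2 k), KZ.of s - c ∈ KZ.relations := by
  classical
  -- a vanishing active letter makes the integrand zero
  by_cases hL : ∃ j, e j ≠ 0 ∧ L j = 0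
  · obtain ⟨j, hej, hLj⟩ := hL
    refine ⟨0, zero_mem _, ?_⟩
    rw [sub_zero]
    refine KZ.of_mem_relations_of_eqOn_zero s fun z hz => ?_
    rw [hint hz]
    have h0 : affF b k (L j) z ^ e j = 0 := by
      rw [hLj]; simp [affF, zero_pow hej]
    simp only [Pi.zero_apply]
    rw [Finset.prod_eq_zero (Finset.mem_univ j) h0, div_zero, zero_mul]
  push Not at hL
  -- the separation shape of the input
  set lam : Fin m → (Fin b → ℚ) × ℚ := fun j => root b (L j) with hlam
  set d : Fin m → ℕ := fun j => if (L j).1 (Fin.last b) = 0 then 0 else e j with hdd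
  set Lb : Fin m → (Fin b → ℚ) × ℚ := fun j => if (L j).1 (Fin.last b) = 0 then restr b (L j)
    else (0, 1) with hLb
  set eb : Fin m → ℕ := fun j => if (L j).1 (Fin.last b) = 0 then e j else 0 with heb
  set p' : MvPolynomial (Fin (b + 1)) ℚ := MvPolynomial.C (∏ j, lead b (L j) (e j))⁻¹ * p with hp'
  have hd : ∀ j, d j ≠ 0 → (L j).1 (Fin.last b) ≠ 0 ∧ e j ≠ 0 := fun j hj => by
    have hdj : d j = if (L j).1 (Fin.last b) = 0 then 0 else e j := rfl
    by_cases h : (L j).1 (Fin.last b) = 0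
    · rw [hdj, if_pos h] at hj; exact absurd rfl hj
    · rw [hdj, if_neg h] at hj; exact ⟨h, hj⟩
  have hshape : EqOn s.integrand (shape b k p' Lb eb lam d a) s.domain := fun z hz => by
    rw [hint hz]; exact jshape_eq L e _ a z
  set act : Fin m → Prop := fun j => (L j).1 (Fin.last b) ≠ 0 ∧ e j ≠ 0 with hactdef
  have hd' : ∀ j, act j → d j ≠ 0 := fun j hj => by
    have hdj : d j = if (L j).1 (Fin.last b) = 0 then 0 else e j := rfl
    rw [hdj, if_neg hj.1]
    exact hj.2
  -- the hypotheses of the engine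
  have hpole' : ∀ j, d j ≠ 0 → ∀ z ∈ s.domain,
      z (Fin.castAdd k (Fin.last b)) - affB b k (lam j) z ≠ 0 := fun j hj z hz => by
    obtain ⟨hα, he⟩ := hd j hj
    have h := hpole j hα he z hz
    rw [affF_of_ne_zero (L j) z hα] at h
    exact right_ne_zero_of_mul h
  have hrat' : ∀ j j', act j → act j' → lam j ≠ lam j' →
      ∃ C, ∀ z ∈ gDom b k m' M lo hi, |z (Fin.castAdd k (Fin.last b)) - affB b k (lam j') z| ≤
        C * |affB b k (lam j) z - affB b k (lam j') z| := by
    rintro j j' ⟨hα, he⟩ ⟨hα', he'⟩ hne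
    obtain ⟨C, hC⟩ := hrat j j' hα hα' he he' fun h => hne (root_eq_of_smul_eq hα hα' h)
    rw [← hdom]
    exact ⟨C * |((L j).1 (Fin.last b) : ℝ)|, fun z hz => ratio_of_literal (L j) (L j') hα hα' z
      (hC z hz)⟩
  -- every family of active poles is unblocked (part `KUnblocked`)
  have hunb := hunb_of_ratio M lo hi lam act
    (fun j hj z hz => hpole' j (hd' j hj) z (by rw [hdom]; exact hz)) hrat'
  have hinv0 : ∀ l, eb l ≠ 0 → ∀ z ∈ closure s.domain, affB b k (Lb l) z = 0 →
      (∃ i, d i ≠ 0) ∧ ∀ i, d i ≠ 0 → z (Fin.castAdd k (Fin.last b)) = affB b k (lam i) z := by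
    intro l hl z _ h0
    exfalso
    have hel : eb l = if (L l).1 (Fin.last b) = 0 then e l else 0 := rfl
    by_cases hy : (L l).1 (Fin.last b) = 0
    · rw [hel, if_pos hy] at hl
      have hlin : (L l).1 = 0 := by
        by_contra h; exact hact l hl h hy
      have hc2 : (L l).2 ≠ 0 := fun h => hL l hl (Prod.ext hlin h)
      have hL' : Lb l = restr b (L l) := by
        show (if (L l).1 (Fin.last b) = 0 then restr b (L l) else (0, 1)) = _; rw [if_pos hy]
      rw [hL'] at h0
      simp only [affB, restr, hlin, Pi.zero_apply, Rat.cast_zero, zero_mul,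
        Finset.sum_const_zero, zero_add, Rat.cast_eq_zero] at h0
      exact hc2 h0
    · rw [hel, if_neg hy] at hl; exact hl rfl
  -- separation + terminal theorem
  set T : Set KZ.FormalRep := {w | ∃ c ∈ AddSubgroup.closure (GGset b 2 k),
    w - c ∈ KZ.relations} with hTdef
  have hT := fun (n : ℕ) (L' : Fin n → (Fin b → ℚ) × ℚ) (e' : Fin n → ℕ) (d' : Fin m → ℕ)
    (s' : KZ.IntegralRep (b + 1 + k)) (ℓ : (Fin b → ℚ) × ℚ) hbd'' hdom' hint' hpole'' hℓ hinv =>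
    show KZ.of s' ∈ T from
      terminal_of_hH_two hHb M p' lam a lo hi L' e' d' s' ℓ hbd'' hdom' hint' hpole'' hℓ hinv ha2 hb2
  obtain ⟨c, hc, hsc⟩ := sepC_induction b k m' m M p' lam a lo hi act T hT hrat' hunb (∑ j, d j)
    m Lb eb d s rfl hbd hdom hshape hpole' hd hinv0
  obtain ⟨c', hc', hcc⟩ := SepTwoZero.closure_transfer' (S := T) (T := GGset b 2 k)
    (fun x hx => hx) c hc
  refine ⟨c', hc', ?_⟩
  have := add_mem hsc hcc
  rwa [sub_add_sub_cancel] at this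

/-- **Engine base dimension `3`, unconditional**: `piece_sigmaTwo` at `b = 2` with the landed
termwise-convergence lemma `separateThree_hHk`. -/
theorem piece_sigmaTwo_three {k m m' : ℕ} (s : KZ.IntegralRep (2 + 1 + k))
    (M : Fin m' → (Fin (2 + 1) → ℚ) × ℚ) (L : Fin m → (Fin (2 + 1) → ℚ) × ℚ) (e : Fin m → ℕ)
    (p : MvPolynomial (Fin (2 + 1)) ℚ) (a : Fin k → Option ((Fin (2 + 1) → ℚ) × ℚ))
    (lo hi : Fin k → Fin k ⊕ ((Fin (2 + 1) → ℚ) × ℚ))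
    (hbd : Bornology.IsBounded s.domain) (hdom : s.domain = gDom 2 k m' M lo hi)
    (hint : EqOn s.integrand (fun z => MvPolynomial.aeval (fun i => z (Fin.castAdd k i)) p /
      (∏ j, affF 2 k (L j) z ^ e j) * fib 2 k a z) s.domain)
    (hact : ∀ j, e j ≠ 0 → (L j).1 ≠ 0 → (L j).1 (Fin.last 2) ≠ 0)
    (hpole : ∀ j, (L j).1 (Fin.last 2) ≠ 0 → e j ≠ 0 → ∀ z ∈ s.domain, affF 2 k (L j) z ≠ 0)
    (hrat : ∀ j j', (L j).1 (Fin.last 2) ≠ 0 → (L j').1 (Fin.last 2) ≠ 0 → e j ≠ 0 → e j' ≠ 0 →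
      (L j').1 (Fin.last 2) • L j ≠ (L j).1 (Fin.last 2) • L j' → ∃ C : ℝ, ∀ z ∈ s.domain,
      |affF 2 k (L j') z| ≤ C * |((L j).1 (Fin.last 2) : ℝ) * affF 2 k (L j') z -
        ((L j').1 (Fin.last 2) : ℝ) * affF 2 k (L j) z|)
    (ha2 : ∀ i c, a i = some c → c.1 (Fin.last 2) = 0)
    (hb2 : ∀ i c, (lo i = Sum.inr c ∨ hi i = Sum.inr c) →
      (c.1 (Fin.last 2) = 0 ∨ c = (Pi.single (Fin.last 2) 1, 0))) :
    ∃ c ∈ AddSubgroup.closure (GGset 2 2 k), KZ.of s - c ∈ KZ.relations :=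
  piece_sigmaTwo separateThree_hHk s M L e p a lo hi hbd hdom hint hact hpole hrat ha2 hb2

end SepThreeK

/-- **Registered part of `stub_rebaseSimplePosOnePos` (line `janus-bands`): the separation
engine with fibres over a base of dimension `3` preserves a rebased fibre structure.** A literal
arrangement representation over `gDom 2 k` in engine coordinates (every active non-constant
letter a `y`-letter, active letters non-vanishing on the cell, pairwise ratio conditions) whose
fibre letters are free of `y` and whose affine fibre bounds are free of `y` or equal to `y` is
congruent modulo `KZ.relations` to a `ℤ`-combination of elements of `GG 2 2 k`
(`SepThreeK.piece_sigmaTwo_three`; rule 1b throughout, termwise convergence by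
`separateThree_hHk`). -/
theorem rebaseSimplePos_pieceSigmaTwo (k m m' : ℕ) (s : KZ.IntegralRep (2 + 1 + k)) (M : Fin m' → (Fin (2 + 1) → ℚ) × ℚ) (L : Fin m → (Fin (2 + 1) → ℚ) × ℚ) (e : Fin m → ℕ) (p : MvPolynomial (Fin (2 + 1)) ℚ) (a : Fin k → Option ((Fin (2 + 1) → ℚ) × ℚ)) (lo hi : Fin k → Fin k ⊕ ((Fin (2 + 1) → ℚ) × ℚ)) (hbd : Bornology.IsBounded s.domain) (hdom : s.domain = SeparatePos.gDom 2 k m' M lo hi) (hint : EqOn s.integrand (fun z => MvPolynomial.aeval (fun i => z (Fin.castAdd k i)) p / (∏ j, SeparatePos.affF 2 k (L j) z ^ e j) * SeparatePos.fib 2 k a z) s.domain) (hact : ∀ j, e j ≠ 0 → (L j).1 ≠ 0 → (L j).1 (Fin.last 2) ≠ 0) (hpole : ∀ j, (L j).1 (Fin.last 2) ≠ 0 → e j ≠ 0 → ∀ z ∈ s.domain, SeparatePos.affF 2 k (L j) z ≠ 0) (hrat : ∀ j j', (L j).1 (Fin.last 2) ≠ 0 → (L j').1 (Fin.last 2) ≠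 0 → e j ≠ 0 → e j' ≠ 0 → (L j').1 (Fin.last 2) • L j ≠ (L j).1 (Fin.last 2) • L j' → ∃ C : ℝ, ∀ z ∈ s.domain, |SeparatePos.affF 2 k (L j') z| ≤ C * |((L j).1 (Fin.last 2) : ℝ) * SeparatePos.affF 2 k (L j') z - ((L j').1 (Fin.last 2) : ℝ) * SeparatePos.affF 2 k (L j) z|) (ha2 : ∀ i c, a i = some c → c.1 (Fin.last 2) = 0) (hb2 : ∀ i c, (lo i = Sum.inr c ∨ hi i = Sum.inr c) → (c.1 (Fin.last 2) = 0 ∨ c = (Pi.single (Fin.last 2) 1, 0))) : ∃ c ∈ AddSubgroup.closure (SeparatePos.GGset 2 2 k), KZ.of s - c ∈ KZ.relations :=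
  SepThreeK.piece_sigmaTwo_three s M L e p a lo hi hbd hdom hint hact hpole hrat ha2 hb2

end Summit.KontsevichZagierPeriods.ArrangementNormalForm.JanusBands
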